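import Literature.Probability.RandomPlanarGeometry.SLERestrictionHitChain
import Literature.Probability.RandomPlanarGeometry.LoewnerMapProofs
import HarnessLib

/-!
# Scales for the assembly of [LSW] Lemma 6.3: the picture at the hitting time

With chain data `Λ, β, x_b, x_*` in the hull `A` (`SLERestrictionHitChain`) and the map
`F = g_T - W_T` at the hitting time `T` (under which `F ∘ β → 0` at `1⁻`, the content of
`IsSmoothHull.hitPath_tendsto`), we prepare the geometric sequence of scales of the multi-scale
argument:

* `Loewner.map_sub_driving_ne_zero` — `g_T(z) ≠ W_T` for points still flowing at time `T`;
* `continuousOn_map_comp` — `x ↦ F(β x)` is continuous on `[0, x]`, `x < 1`;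
* `exists_pos_forall_le_norm` — `m(x) = min_{Γ_x} ‖F‖ > 0` on the chain set `Γ_x`;
* `exists_first_entrance` — first entrance of `‖F ∘ β‖` below a level after a parameter;
* `exists_scaleSeq` — an increasing sequence `x_k ↑` in `(x_*, 1)` such that
  `‖F(β x_{k+1})‖ ≤ ρ_k/11 < ‖F(β y)‖` for `x_k ≤ y < x_{k+1}`, where
  `ρ_k = m_k/(640 √(1 + c'²))` and `m_k ≤ ‖F‖` on `Γ_{x_k}`.
-/

noncomputable section

open Set Filter Metric Complex
open _root_.Topology
open UpperHalfPlane (upperHalfPlaneSet isOpen_upperHalfPlaneSet)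
open Literature.Topology.PlaneTopology
open scoped NNReal unitInterval

namespace Literature.Probability.RandomPlanarGeometry

namespace Loewner

variable {W : ℝ≥0 → ℝ}

/-- A point still flowing at time `t` has `g_t(z) ≠ W_t`. [folklore] -/
theorem map_sub_driving_ne_zero (hW : Continuous W) {t : ℝ≥0} {z : ℂ}
    (hz : (t : WithTop ℝ≥0) < swallowingTime W z) : map W t z - W t ≠ 0 := by
  obtain ⟨g, hg⟩ := exists_isSolution_swallowingTime_holds hW (ne_driving_of_lt_swallowingTime hz)
  rw [map_eq_of_isSolution hW hg hz, sub_ne_zero]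
  have := hg.ne t.coe_nonneg (by rw [Real.toNNReal_coe]; exact hz)
  rwa [Real.toNNReal_coe] at this

/-- `z ↦ g_t(z) - W_t` is continuous on any set of points still flowing at time `t`.
[folklore] -/
theorem continuousOn_map_sub_driving (hW : Continuous W) {t : ℝ≥0} {K : Set ℂ}
    (hK : ∀ z ∈ K, (t : WithTop ℝ≥0) < swallowingTime W z) :
    ContinuousOn (fun z ↦ map W t z - W t) K := fun z hz ↦
  ((continuousAt_map hW (hK z hz)).sub continuousAt_const).continuousWithinAt

end Loewner

section Scales

variable {W : ℝ≥0 → ℝ} {A Λ : Set ℂ} {β : ℝ → ℂ} {xb xs : ℝ} {τ : ℝ≥0}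

/-- `x ↦ g_T(β x) - W_T` is continuous on `[0, x₁]` for `x₁ < 1` (all these points are still
flowing at time `T`). [folklore] -/
theorem IsChainData.continuousOn_map_comp (h : IsChainData A Λ β xb xs) (hW : Continuous W)
    (hA : IsArcHull A) (hτ : Loewner.IsHullHitTime W A τ)
    (hreal : ∀ x : ℝ, (x : ℂ) ∈ A → ¬ Loewner.swallowingTime W x ≤ (τ : WithTop ℝ≥0))
    {x₁ : ℝ} (hx₁ : x₁ < 1) :
    ContinuousOn (fun x ↦ Loewner.map W τ (β x) - W τ) (Icc 0 x₁) := by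
  have hK : ∀ z ∈ β '' Icc 0 x₁, (τ : WithTop ℝ≥0) < Loewner.swallowingTime W z := by
    rintro _ ⟨y, hy, rfl⟩
    exact hτ.lt_swallowingTime_of_mem_interior hW hA hreal (h.mem_int y ⟨hy.1, lt_of_le_of_lt hy.2 hx₁⟩)
  exact (Loewner.continuousOn_map_sub_driving hW hK).comp (h.cont.mono (Icc_subset_Icc_right hx₁.le))
    (mapsTo_image _ _)

/-- **`‖g_T - W_T‖` is bounded below by a positive constant on the chain set `Γ_x`**
(compactness; no point of `Γ_x` is swallowed at time `T`). [folklore] -/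
theorem IsChainData.exists_pos_forall_le_norm (h : IsChainData A Λ β xb xs) (hW : Continuous W)
    (hA : IsArcHull A) (hτ : Loewner.IsHullHitTime W A τ)
    (hreal : ∀ x : ℝ, (x : ℂ) ∈ A → ¬ Loewner.swallowingTime W x ≤ (τ : WithTop ℝ≥0))
    {x : ℝ} (hx : xs < x) (hx1 : x < 1) :
    ∃ m > 0, (∀ z ∈ Λ ∪ β '' Icc xs x, m ≤ ‖Loewner.map W τ z - W τ‖) ∧
      ∃ z₀ ∈ Λ ∪ β '' Icc xs x, ‖Loewner.map W τ z₀ - W τ‖ = m := by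
  have hK := h.isCompact_chain hx hx1.le
  have hT : ∀ z ∈ Λ ∪ β '' Icc xs x, (τ : WithTop ℝ≥0) < Loewner.swallowingTime W z := fun z hz ↦
    h.lt_swallowingTime_of_mem_chain hW hA hτ hreal hx1 hz
  have hcont : ContinuousOn (fun z ↦ ‖Loewner.map W τ z - W τ‖) (Λ ∪ β '' Icc xs x) :=
    (Loewner.continuousOn_map_sub_driving hW hT).norm
  have hne : (Λ ∪ β '' Icc xs x).Nonempty := ⟨xb, Or.inl h.arc.left_mem⟩
  obtain ⟨z₀, hz₀, hmin⟩ := hK.exists_isMinOn hne hcont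
  refine ⟨‖Loewner.map W τ z₀ - W τ‖, norm_pos_iff.2 (Loewner.map_sub_driving_ne_zero hW (hT z₀ hz₀)),
    fun z hz ↦ hmin hz, z₀, hz₀, rfl⟩

/-- **First entrance below a level.** If `F ∘ β → 0` at `1⁻` (`F = g_T - W_T`) and
`r < ‖F(β x₀)‖`, `0 < r`, there is a first parameter `x₁ ∈ (x₀, 1)` with `‖F(β x₁)‖ ≤ r`,
before which `‖F ∘ β‖ > r`. [folklore] -/
theorem IsChainData.exists_first_entrance (h : IsChainData A Λ β xb xs) (hW : Continuous W)
    (hA : IsArcHull A) (hτ : Loewner.IsHullHitTime W A τ)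
    (hreal : ∀ x : ℝ, (x : ℂ) ∈ A → ¬ Loewner.swallowingTime W x ≤ (τ : WithTop ℝ≥0))
    (hlim : Tendsto (fun x ↦ Loewner.map W τ (β x) - W τ) (𝓝[<] 1) (𝓝 0))
    {x₀ : ℝ} (hx₀ : 0 ≤ x₀) (hx₀1 : x₀ < 1) {r : ℝ} (hr : 0 < r)
    (hbig : r < ‖Loewner.map W τ (β x₀) - W τ‖) :
    ∃ x₁, x₀ < x₁ ∧ x₁ < 1 ∧ ‖Loewner.map W τ (β x₁) - W τ‖ ≤ r ∧
      ∀ y ∈ Ico x₀ x₁, r < ‖Loewner.map W τ (β y) - W τ‖ := by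
  set G : ℝ → ℝ := fun x ↦ ‖Loewner.map W τ (β x) - W τ‖ with hG
  -- a parameter `y₁ ∈ (x₀, 1)` with `G y₁ < r`
  have hev : ∀ᶠ x in 𝓝[<] (1 : ℝ), G x < r := by
    have := (continuous_norm.tendsto _).comp hlim
    rw [norm_zero] at this
    exact this.eventually (Iio_mem_nhds hr)
  obtain ⟨y₁, hy₁, hy₁x₀⟩ : ∃ y₁, G y₁ < r ∧ y₁ ∈ Ioo x₀ 1 := by
    have h1 : ∀ᶠ x in 𝓝[<] (1 : ℝ), x ∈ Ioo x₀ 1 := Ioo_mem_nhdsLT hx₀1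
    obtain ⟨y₁, hy₁⟩ := (hev.and h1).exists
    exact ⟨y₁, hy₁.1, hy₁.2⟩
  -- the first parameter in `[x₀, y₁]` where `G ≤ r`
  have hGc : ContinuousOn G (Icc x₀ y₁) :=
    ((h.continuousOn_map_comp hW hA hτ hreal hy₁x₀.2).norm).mono (Icc_subset_Icc_left hx₀)
  set S : Set ℝ := {y | y ∈ Icc x₀ y₁ ∧ G y ≤ r} with hS
  have hScl : IsClosed S := by
    have : S = Icc x₀ y₁ ∩ G ⁻¹' Iic r := by ext y; simp [hS]
    rw [this]; exact hGc.preimage_isClosed_of_isClosed isClosed_Icc isClosed_Iic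
  have hSne : S.Nonempty := ⟨y₁, ⟨hy₁x₀.1.le, le_rfl⟩, hy₁.le⟩
  have hSbdd : BddBelow S := ⟨x₀, fun y hy ↦ hy.1.1⟩
  set x₁ : ℝ := sInf S with hx₁
  have hx₁S : x₁ ∈ S := hScl.csInf_mem hSne hSbdd
  have hx₁gt : x₀ < x₁ := by
    rcases hx₁S.1.1.eq_or_lt with h1 | h1
    · exfalso; have := hx₁S.2; rw [← h1] at this; exact absurd hbig (not_lt.2 this)
    · exact h1
  refine ⟨x₁, hx₁gt, lt_of_le_of_lt hx₁S.1.2 hy₁x₀.2, hx₁S.2, fun y hy ↦ ?_⟩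
  by_contra hle
  rw [not_lt] at hle
  have : x₁ ≤ y := csInf_le hSbdd ⟨⟨hy.1, hy.2.le.trans hx₁S.1.2⟩, hle⟩
  linarith [hy.2]

/-- **The sequence of scales at the hitting time.** Given the cone constant `c'` there is an
increasing sequence `x_k` in `(x_*, 1)` (starting anywhere in `(x_*, 1)`) such that, with
`m_k = min_{Γ_{x_k}} ‖F‖ > 0` and `ρ_k = m_k/(640 √(1+c'²))`: `‖F(β x_{k+1})‖ ≤ ρ_k/11` and
`‖F(β y)‖ > ρ_k/11` for `x_k ≤ y < x_{k+1}`. [folklore] -/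
theorem IsChainData.exists_scaleSeq (h : IsChainData A Λ β xb xs) (hW : Continuous W)
    (hA : IsArcHull A) (hτ : Loewner.IsHullHitTime W A τ)
    (hreal : ∀ x : ℝ, (x : ℂ) ∈ A → ¬ Loewner.swallowingTime W x ≤ (τ : WithTop ℝ≥0))
    (hlim : Tendsto (fun x ↦ Loewner.map W τ (β x) - W τ) (𝓝[<] 1) (𝓝 0)) (c' : ℝ) :
    ∃ (x m : ℕ → ℝ), (∀ k, xs < x k ∧ x k < 1) ∧ (∀ k, x k < x (k + 1)) ∧
      (∀ k, 0 < m k ∧ (∀ z ∈ Λ ∪ β '' Icc xs (x k), m k ≤ ‖Loewner.map W τ z - W τ‖) ∧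
        ∃ z₀ ∈ Λ ∪ β '' Icc xs (x k), ‖Loewner.map W τ z₀ - W τ‖ = m k) ∧
      ∀ k, ‖Loewner.map W τ (β (x (k + 1))) - W τ‖ ≤ m k / (640 * Real.sqrt (1 + c' ^ 2)) / 11 ∧
        ∀ y ∈ Ico (x k) (x (k + 1)), m k / (640 * Real.sqrt (1 + c' ^ 2)) / 11 <
          ‖Loewner.map W τ (β y) - W τ‖ := by
  classical
  -- the minimum function on `(x_*, 1)` (junk elsewhere)
  have hmin : ∀ x : ℝ, ∃ m : ℝ, (xs < x → x < 1 → 0 < m ∧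
      (∀ z ∈ Λ ∪ β '' Icc xs x, m ≤ ‖Loewner.map W τ z - W τ‖) ∧
      ∃ z₀ ∈ Λ ∪ β '' Icc xs x, ‖Loewner.map W τ z₀ - W τ‖ = m) := by
    intro x
    by_cases hx : xs < x ∧ x < 1
    · obtain ⟨m, hm, hle, hz₀⟩ := h.exists_pos_forall_le_norm hW hA hτ hreal hx.1 hx.2
      exact ⟨m, fun _ _ ↦ ⟨hm, hle, hz₀⟩⟩
    · exact ⟨1, fun h1 h2 ↦ absurd ⟨h1, h2⟩ hx⟩
  choose mf hmf using hmin
  -- the step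
  have hsq : 0 < 640 * Real.sqrt (1 + c' ^ 2) := by positivity
  have hstep : ∀ x : ℝ, ∃ x' : ℝ, (xs < x → x < 1 → x < x' ∧ x' < 1 ∧
      ‖Loewner.map W τ (β x') - W τ‖ ≤ mf x / (640 * Real.sqrt (1 + c' ^ 2)) / 11 ∧
      ∀ y ∈ Ico x x', mf x / (640 * Real.sqrt (1 + c' ^ 2)) / 11 < ‖Loewner.map W τ (β y) - W τ‖) := by
    intro x
    by_cases hx : xs < x ∧ x < 1
    · obtain ⟨hm, hle, -⟩ := hmf x hx.1 hx.2
      have hr : 0 < mf x / (640 * Real.sqrt (1 + c' ^ 2)) / 11 := by positivity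
      have hbig : mf x / (640 * Real.sqrt (1 + c' ^ 2)) / 11 < ‖Loewner.map W τ (β x) - W τ‖ := by
        have h1 := hle (β x) (Or.inr ⟨x, ⟨hx.1.le, le_rfl⟩, rfl⟩)
        have h2 : mf x / (640 * Real.sqrt (1 + c' ^ 2)) / 11 < mf x := by
          rw [div_div, div_lt_iff₀ (by positivity)]
          have : 1 < 640 * Real.sqrt (1 + c' ^ 2) * 11 := by
            have := Real.one_le_sqrt.2 (show (1 : ℝ) ≤ 1 + c' ^ 2 by nlinarith)
            nlinarith
          nlinarith
        linarith
      obtain ⟨x', h1, h2, h3, h4⟩ := h.exists_first_entrance hW hA hτ hreal hlim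
        (h.xs_mem.1.trans hx.1.le) hx.2 hr hbig
      exact ⟨x', fun _ _ ↦ ⟨h1, h2, h3, h4⟩⟩
    · exact ⟨x, fun h1 h2 ↦ absurd ⟨h1, h2⟩ hx⟩
  choose next hnext using hstep
  -- the sequence
  obtain ⟨x₀, hx₀, hx₀1⟩ : ∃ x₀, xs < x₀ ∧ x₀ < 1 := ⟨(xs + 1) / 2, by linarith [h.xs_mem.2], by linarith [h.xs_mem.2]⟩
  set x : ℕ → ℝ := fun k ↦ Nat.rec x₀ (fun _ y ↦ next y) k with hxdef
  have hx_succ : ∀ k, x (k + 1) = next (x k) := fun k ↦ rfl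
  have hxrange : ∀ k, xs < x k ∧ x k < 1 := by
    intro k
    induction k with
    | zero => exact ⟨hx₀, hx₀1⟩
    | succ k ih =>
      obtain ⟨h1, h2, -⟩ := hnext (x k) ih.1 ih.2
      rw [hx_succ]
      exact ⟨ih.1.trans h1, h2⟩
  refine ⟨x, fun k ↦ mf (x k), hxrange, fun k ↦ ?_, fun k ↦ hmf (x k) (hxrange k).1 (hxrange k).2, fun k ↦ ?_⟩
  · rw [hx_succ]; exact (hnext (x k) (hxrange k).1 (hxrange k).2).1
  · obtain ⟨-, -, h3, h4⟩ := hnext (x k) (hxrange k).1 (hxrange k).2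
    rw [hx_succ]
    exact ⟨h3, h4⟩

end Scales

end Literature.Probability.RandomPlanarGeometry
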